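import Mathlib
import Summits.QuantumFields.YangMills.Theorems.SmallFieldWideningLargeFieldMassRefinementTailElementaryEnvelopeProfile
import Summits.QuantumFields.YangMills.Theorems.SmallFieldWideningLargeFieldMassRefinementTailOfHeightTail

/-!
# Route `SmallFieldWidening` — crux r3 `LargeFieldMassRefinementTail` (stmt-QuantumFields-22884), line `birth`: THE ELEMENTARY ENVELOPE of the
# block-averaged large-field tail, file 3 of 3: r3's own currency on the envelope (unconditionally) and the crux BY NAME from the heights OFF it
# (support file, instrument row; the stub `stub_avgTailPkg` and the crux stay open)

Width seat `ym-line-sfw-p2-w2` (gen 4), 2026-08-28; sequel of `…ElementaryEnvelope` / `…ElementaryEnvelopeProfile` (ONE summable profile `q`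
bounding `Gibbs_K{¬PlaqSmall θ(K−j) (Ū^{j})}` at every `(K, j)` of the elementary envelope `E = {j ≤ K, ((151L²)^j)² ≤ p(g_{K−j})}`, and
`AveragedTailAt` from any profile off `E`).  THIS FILE:

* §6 **`freeTopSteps_mass_on_envelope`** — in r3's free-top-steps currency (`…FreeTopSteps`: run `N` of `F` with the top `n` heights free IS run
  `N − n` of `F.refine n` at coupling `γL^{−n}`): `δ n := Σ'_t q(t+n) → 0` bounds, for EVERY `n` and EVERY run `N`, the Gibbs mass of «some
  constrained height `j ≤ N − n` INSIDE the envelope carries a `θ(N−j)`-large averaged plaquette» — the envelope part of r3, unconditionally,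
  for every family and every `0 < γ ≤ 1`;
* §7 **`largeFieldMassRefinementTail_of_offEnvelope`** — the crux BY NAME from a profile for the heights OFF the envelope at every family of each
  block size (route prefix `∀ L ∃ b₀ p₀ γ₁ …`), by §4 and the landed level-shift bridge
  `LargeFieldMassRefinementTailOfHeightTail.largeFieldMassRefinementTail_of_averagedTail` (w2, p579220).  CONDITIONAL — it credits nothing; it
  records that the located open content of stmt-QuantumFields-22884 is exactly the super-logarithmic averaged heights (Bałaban's (α)
  representation; tree frontier `AlphaInputsT3ACv3RecChi`).

No summit is proved (rung R3 record; the YM mass gap is NOT touched).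

References: T. Bałaban, CMP **102** (1985) 255–275 [Balaban1985UV3] ((7) p.257, (41) p.266, (71) p.273).
-/

noncomputable section

namespace Summit.QuantumFields.YangMills.Theorems.LargeFieldMassRefinementTailElementaryEnvelope

open MeasureTheory
open scoped BigOperators
open Literature.MathematicalPhysics.QuantumFieldTheory (Plaquette)
open Literature.MathematicalPhysics.QuantumFieldTheory.Balaban1983to89
open Literature.MathematicalPhysics.QuantumFieldTheory.Balaban1983to89.T3ContinuumYM3Torus
open Literature.MathematicalPhysics.QuantumFieldTheory.Balaban1983to89.T3UnitScaleTilt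
open Literature.MathematicalPhysics.QuantumFieldTheory.Balaban1983to89.T3UnitLawDensityEML
open Literature.MathematicalPhysics.QuantumFieldTheory.Balaban1983to89.T3CruxEstimates
open Literature.MathematicalPhysics.QuantumFieldTheory.Balaban1983to89.T3FinestHeightTail
open Literature.MathematicalPhysics.QuantumFieldTheory.Balaban1983to89.T3BareTailProfile
open Literature.MathematicalPhysics.QuantumFieldTheory.Balaban1983to89.T4PairDerivBridge (dist1_le_two_specialUnitaryGroup)
open Literature.MathematicalPhysics.QuantumFieldTheory.Balaban1983to89.T3UpperLiftSplit (scheme_β_eq)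
open Summit.QuantumFields.YangMills.Theorems.HistoryTailBoundedHeight

/-! ## §6 In r3's currency: the envelope part of the all-heights large-field mass with `n` free top steps is `o(1)` in `n`, uniformly in the run -/

section FreeTopSteps

open Filter Topology

/-- **THE ENVELOPE PART OF r3, UNCONDITIONALLY** (`0 < γ ≤ 1`, `0 < b₀`, `2 ≤ p₀`; one family `F`, in the free-top-steps currency of
`…FreeTopSteps`: run `N` of `F` with the top `n` heights free IS run `N − n` of `F.refine n` at coupling `γL^{−n}`): there is `δ : ℕ → ℝ` with
`δ n → 0` such that for EVERY `n` and EVERY run `N` the Gibbs mass of «some CONSTRAINED height `j ≤ N − n` lying in the elementary envelope carries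
a `θ(N−j)`-large averaged plaquette» is `≤ δ n` — the union over the envelope heights of §3's profile, `δ n = Σ_{t} q(t+n)` (`tendsto_sum_nat_add`).
What r3 asks beyond this is the same statement for the heights OFF the envelope (§4). [cite: Balaban1985UV3, (7) p.257 and (71) p.273] -/
theorem freeTopSteps_mass_on_envelope (F : T3Family) {γ b₀ p₀ : ℝ} (hγ : 0 < γ) (hγ1 : γ ≤ 1) (hb₀ : 0 < b₀) (hp₀ : 2 ≤ p₀) :
    ∃ δ : ℕ → ℝ, Tendsto δ atTop (nhds 0) ∧ ∀ n N : ℕ,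
      (gibbsK F ℰp γ N).real
          {U | ∃ j, j + n ≤ N ∧
              ((151 * (F.L : ℝ) ^ 2) ^ j) ^ 2 ≤ B10.pFun b₀ p₀ (Real.sqrt (γ * ((F.L : ℝ)⁻¹) ^ (N - j))) ∧
              ¬ PlaqSmall (θBal F.L γ b₀ p₀ (N - j))
                (Averaging.iter (fun i => BlockAveraging.blockAvg (P := F.P N) (j := i) ℰp) j U)} ≤ δ n := by
  obtain ⟨q, hq0, hq, -, hon⟩ := averagedTail_on_envelope F hγ hγ1 hb₀ hp₀
  refine ⟨fun n => ∑' t, q (t + n), tendsto_sum_nat_add q, fun n N => ?_⟩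
  haveI := isProbabilityMeasure_gibbsK F ℰp hγ.le N
  have hs : Summable fun t => q (t + n) := (summable_nat_add_iff n).mpr hq
  classical
  -- the admissible heights
  set S : Finset ℕ := (Finset.range (N + 1)).filter fun j => j + n ≤ N ∧
      ((151 * (F.L : ℝ) ^ 2) ^ j) ^ 2 ≤ B10.pFun b₀ p₀ (Real.sqrt (γ * ((F.L : ℝ)⁻¹) ^ (N - j))) with hS
  have hmemS : ∀ {j : ℕ}, j ∈ S ↔ j < N + 1 ∧ j + n ≤ N ∧
      ((151 * (F.L : ℝ) ^ 2) ^ j) ^ 2 ≤ B10.pFun b₀ p₀ (Real.sqrt (γ * ((F.L : ℝ)⁻¹) ^ (N - j))) := by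
    intro j
    rw [hS, Finset.mem_filter, Finset.mem_range]
  -- the event is contained in the union over the admissible heights of the height-`j` large-field events
  have hsub : {U : GaugeField (F.P N) 0 (Matrix.specialUnitaryGroup (Fin 2) ℂ) | ∃ j, j + n ≤ N ∧
        ((151 * (F.L : ℝ) ^ 2) ^ j) ^ 2 ≤ B10.pFun b₀ p₀ (Real.sqrt (γ * ((F.L : ℝ)⁻¹) ^ (N - j))) ∧
        ¬ PlaqSmall (θBal F.L γ b₀ p₀ (N - j))
          (Averaging.iter (fun i => BlockAveraging.blockAvg (P := F.P N) (j := i) ℰp) j U)} ⊆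
      ⋃ j ∈ S, {U | ¬ PlaqSmall (θBal F.L γ b₀ p₀ (N - j))
          (Averaging.iter (fun i => BlockAveraging.blockAvg (P := F.P N) (j := i) ℰp) j U)} := by
    intro U hU
    obtain ⟨j, hjn, henv, hbad⟩ := hU
    simp only [Set.mem_iUnion, Set.mem_setOf_eq, exists_prop]
    exact ⟨j, hmemS.mpr ⟨by omega, hjn, henv⟩, hbad⟩
  -- reindexing `j ↦ N − j − n` is injective on `S`
  have hinj : ∀ j ∈ S, ∀ j' ∈ S, N - j - n = N - j' - n → j = j' := by
    intro j hj j' hj' h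
    have h1 := (hmemS.mp hj).2.1
    have h2 := (hmemS.mp hj').2.1
    omega
  calc (gibbsK F ℰp γ N).real
        {U | ∃ j, j + n ≤ N ∧
            ((151 * (F.L : ℝ) ^ 2) ^ j) ^ 2 ≤ B10.pFun b₀ p₀ (Real.sqrt (γ * ((F.L : ℝ)⁻¹) ^ (N - j))) ∧
            ¬ PlaqSmall (θBal F.L γ b₀ p₀ (N - j))
              (Averaging.iter (fun i => BlockAveraging.blockAvg (P := F.P N) (j := i) ℰp) j U)}
      ≤ (gibbsK F ℰp γ N).real (⋃ j ∈ S, {U | ¬ PlaqSmall (θBal F.L γ b₀ p₀ (N - j))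
          (Averaging.iter (fun i => BlockAveraging.blockAvg (P := F.P N) (j := i) ℰp) j U)}) :=
        measureReal_mono hsub (measure_ne_top _ _)
    _ ≤ ∑ j ∈ S, (gibbsK F ℰp γ N).real {U | ¬ PlaqSmall (θBal F.L γ b₀ p₀ (N - j))
          (Averaging.iter (fun i => BlockAveraging.blockAvg (P := F.P N) (j := i) ℰp) j U)} :=
        measureReal_biUnion_finset_le S _
    _ ≤ ∑ j ∈ S, q (N - j) := Finset.sum_le_sum fun j hj => by
        obtain ⟨_, hjn, henv⟩ := hmemS.mp hj
        exact hon N j (by omega) henv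
    _ = ∑ j ∈ S, q ((N - j - n) + n) := Finset.sum_congr rfl fun j hj => by
        obtain ⟨_, hjn, _⟩ := hmemS.mp hj
        rw [show N - j - n + n = N - j by omega]
    _ = ∑ t ∈ S.image (fun j => N - j - n), q (t + n) := by
        rw [Finset.sum_image hinj]
    _ ≤ ∑' t, q (t + n) := hs.sum_le_tsum _ fun t _ => hq0 _

end FreeTopSteps

/-! ## §7 The crux BY NAME from the heights off the envelope (composition with the landed level-shift bridge) -/

section Crux

/-- **r3 `LargeFieldMassRefinementTail` BY NAME FROM THE SUPER-LOGARITHMIC HEIGHTS ALONE**: if for every block size `L` there are a profile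
`(b₀, p₀)` (`0 < b₀`, `2 < p₀`) and a threshold `0 < γ₁ ≤ 1` such that every family with `F.L = L` at every `0 < γ ≤ γ₁` has SOME summable
profile (with summable shifted tails) bounding the height-`j` large-field Gibbs mass at the heights OFF the elementary envelope
(`p(g_{K−j}) < ((151L²)^j)²`, `1 ≤ j ≤ K`), then the crux holds — §4 (`averagedTailAt_of_offEnvelope`, the envelope being free by §3) composed
with the landed bridge `LargeFieldMassRefinementTailOfHeightTail.largeFieldMassRefinementTail_of_averagedTail` (w2, p579220).  The located open
content of stmt-QuantumFields-22884 is therefore EXACTLY the large-field tail at the super-logarithmic averaged heights (Bałaban's (α) representation,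
[Balaban1985UV3] (41)/(71); tree frontier `AlphaInputsT3ACv3RecChi`).  Conditional; nothing here discharges it. [cite: Balaban1985UV3, (41) p.266 and (71) p.273] -/
theorem largeFieldMassRefinementTail_of_offEnvelope
    (h : ∀ L : ℕ, ∃ b₀ p₀ γ₁ : ℝ, 0 < b₀ ∧ 2 < p₀ ∧ 0 < γ₁ ∧ γ₁ ≤ 1 ∧
      ∀ (F : T3Family) (γ : ℝ), F.L = L → 0 < γ → γ ≤ γ₁ →
        ∃ q' : ℕ → ℝ, (∀ i, 0 ≤ q' i) ∧ Summable q' ∧ (Summable fun n => ∑' t, q' (t + n)) ∧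
          ∀ K j : ℕ, 1 ≤ j → j ≤ K →
            B10.pFun b₀ p₀ (Real.sqrt (γ * ((F.L : ℝ)⁻¹) ^ (K - j))) < ((151 * (F.L : ℝ) ^ 2) ^ j) ^ 2 →
            (gibbsK F ℰp γ K).real
                {U | ¬ PlaqSmall (θBal F.L γ b₀ p₀ (K - j))
                  (Averaging.iter (fun i => BlockAveraging.blockAvg (P := F.P K) (j := i) ℰp) j U)} ≤ q' (K - j)) :
    Summit.QuantumFields.YangMills.Theses.SmallFieldWidening.LargeFieldMassRefinementTail :=
  LargeFieldMassRefinementTailOfHeightTail.largeFieldMassRefinementTail_of_averagedTail fun L => by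
    obtain ⟨b₀, p₀, γ₁, hb, hp, hγ₁, hγ₁1, h⟩ := h L
    exact ⟨b₀, p₀, γ₁, hb, hp, hγ₁, hγ₁1, fun F γ hFL hγ hle =>
      averagedTailAt_of_offEnvelope F hγ (hle.trans hγ₁1) hb (by linarith) (h F γ hFL hγ hle)⟩

end Crux

end Summit.QuantumFields.YangMills.Theorems.LargeFieldMassRefinementTailElementaryEnvelope

end
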